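import Summits.HodgeConjecture.HodgeConjecture.Theses.AnchorTransport
import Summits.HodgeConjecture.HodgeConjecture.Theorems.AnchorTransportTargetIffHodgeConjecture
import Summits.HodgeConjecture.HodgeConjecture.Theorems.AnchorTransportAnchorExistenceTransport
import Summits.HodgeConjecture.HodgeConjecture.Theorems.AnchorTransportAnchorExistenceFloor
import Literature.AlgebraicGeometry.HodgeTheory.MotivatedClassesLefschetzRange
import Literature.AlgebraicGeometry.HodgeTheory.HodgeIndexSurface
import Literature.AlgebraicGeometry.HodgeTheory.SupportedClassesHodgeConiveau
import Literature.AlgebraicGeometry.Surfaces.K3ComplexMultiplication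
import Literature.AlgebraicGeometry.Surfaces.K3BettiNumbers
import Literature.AlgebraicGeometry.Surfaces.K3Marking
import Literature.AlgebraicGeometry.Motives.VarietiesDimensionProofs
import Literature.AlgebraicGeometry.HodgeTheory.GlobalInvariantCycles
import Literature.AlgebraicGeometry.HodgeTheory.SemiregularVariationalHodgeProofs
import Literature.AlgebraicGeometry.HodgeTheory.LefschetzOneOneHolds
import Literature.AlgebraicGeometry.HodgeTheory.HardLefschetzNFoldHolds
import Literature.AlgebraicGeometry.HodgeTheory.HodgeIndexPrimitiveAlgebraicHolds
import Literature.AlgebraicGeometry.HodgeTheory.SupportedClassesHodgeConiveauHolds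
import Literature.AlgebraicGeometry.HodgeTheory.InvariantClassesFromTotalSpaceHolds
import Literature.AlgebraicGeometry.Surfaces.K3LatticeInvariantsHolds
import Literature.AlgebraicGeometry.Surfaces.K3SurfaceBuskinLeaves
import Literature.AlgebraicGeometry.Surfaces.K3LatticeInvariantsSignatureProofs
import Literature.AlgebraicGeometry.Surfaces.K3HodgeTypesHolds
import Literature.AlgebraicGeometry.HodgeTheory.HodgeFiltrationModelsReductionProofs
import Summits.HodgeConjecture.HodgeConjecture.Theorems.AnchorTransportAnchorExistenceK3SquareRatEndFloor
import Summits.HodgeConjecture.HodgeConjecture.Theorems.AnchorTransportAnchorExistenceK3SquareCMFloor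

/-!
# Route AnchorTransport — crux `AnchorExistence` (item stmt-HodgeConjecture-1077): LINE SKELETON `Sketch`

Lead skeleton of line `Sketch` (card `Cruxes/AnchorExistence/Ideas/lefschetz-point-anchors.md`): the crux
`AnchorExistence` — every rational `(p,p)`-class `c` on a smooth projective `X` of dimension `n` is, up to an
iso `X ≅ 𝒳_{s₁}`, the restriction of a fibrewise rational `(p,p)` class `A` on the total space of a smooth
projective family `𝒳 ⟶ S` over a smooth irreducible base, ALGEBRAIC on some fibre `𝒳_{s₀}` — is concluded
BY NAME (`anchorTransport_anchorExistence_proof`) from declared stubs that partition its domain: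

* Lefschetz range `p ≤ 1 ∨ n ≤ p + 1`: the class is algebraic on `X` itself — Lefschetz `(1,1)` and hard
  Lefschetz, now the tree's THEOREMS `lefschetzOneOne_rational_holds` (Kodaira–Serre route) and
  `nonempty_hardLefschetzNFold_holds` (Fubini–Study route), no longer stubs (cycle 2) — and the CONSTANT
  FAMILY anchors it (`anchorTransport_anchor_of_mem_algebraicClasses`).
* K3-square sector `X ≅ S ⊗ S`, `S` a projective K3 surface (then `n = 4`, `p = 2`), split by the endomorphism
  field `K = End_Hdg(T(S)_ℚ)`: `K = ℚ` (floor: Künneth bookkeeping on `S ⊗ S`,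
  `anchorExistence_k3Square_floor_of_ratEnd`, LANDED, modulo the K3/Künneth named facts), CM (floor: Buskin's
  corollary DERIVED from his Thm. 1.1, `anchorExistence_k3Square_floor_of_CM`, LANDED), totally real `K ≠ ℚ`
  (REAL MULTIPLICATION — the line's GEOGRAPHY heart `anchorExistence_k3Square_flatSection_of_realMult`: a flat
  family of Hodge classes over a CM-anchored smooth projective family (the RM Shimura variety), turned into a
  global class by the theorem of the fixed part; the anchor fibre `S₀ ⊗ S₀` is then a CM floor,
  `anchorTransport_anchor_of_floor`; the global class on the total space comes from Deligne's 1968 theorem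
  "invariant classes come from the total space", the tree's theorem
  `deligne1968_invariantClass_fromTotalSpace_holds` — the partie fixe stub of cycle 1 is gone). The named facts
  the sector's floors consume are single-fact stubs (cycle-2 reshape of the former bundle
  `anchorExistence_stub_k3SquareFacts`): `K3_finrank_complexBetti_two` (`anchorExistence_stub_k3BettiTwo`, the
  one undischarged leaf of the K3 marking `anchorExistence_k3Marking`, wave 1),
  `Huybrechts_K3_oddBetti_vanish` (`anchorExistence_stub_k3OddBetti`), and the three undischarged leaves of
  `Buskin2019_hodgeIsometry_algebraic` (`anchorExistence_buskin`, wave 1): `Buskin2019_reflectiveHodgeIsometry_algebraic`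
  (`anchorExistence_stub_buskinReflective`), `cupProduct_mem_algebraicClasses_tripleProduct_surfaces`
  (`anchorExistence_stub_cupTripleSurfaces`), `Huybrechts_K3_periodSurjective_projective`
  (`anchorExistence_stub_k3PeriodSurjective`); `hodgeIndex_surface` and `Grothendieck1969_supportedClasses_le_hodgeConiveau`
  are the tree's theorems `hodgeIndex_surface_holds`, `Grothendieck1969_supportedClasses_le_hodgeConiveau_holds`.
* The declared complement (`2 ≤ p ≤ n - 2`, `X` not a K3 square, `c` not already algebraic):
  `anchorExistence_anchor_offK3Squares_of_not_mem`
  (HC-sandwiched on rigid pairs: `anchorTransport_mem_algebraicClasses_of_anchor_of_fiberIso`).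

`sorry` appears only in the stubs; the composition (including the fixed-part / identity-principle glue for
real-multiplication K3 squares) is kernel-checked.
-/

noncomputable section

set_option linter.dupNamespace false

open CategoryTheory AlgebraicGeometry MonoidalCategory
open Literature.AlgebraicGeometry Literature.AlgebraicGeometry.Motives
  Literature.AlgebraicGeometry.HodgeTheory Literature.AlgebraicGeometry.Surfaces
  Literature.AlgebraicTopology.SingularHomology

namespace Summit.HodgeConjecture.HodgeConjecture.Theorems

open Summit.HodgeConjecture.HodgeConjecture.Theses.AnchorTransport

/-! ### Stubs (registered on stmt-HodgeConjecture-1077; `sorry` only here)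

DISCHARGED since cycle 1 (no longer stubs): Lefschetz `(1,1)` = `lefschetzOneOne_rational_holds`
(`HodgeTheory/LefschetzOneOneHolds`), hard Lefschetz = `nonempty_hardLefschetzNFold_holds`
(`HodgeTheory/HardLefschetzNFoldHolds`), the Hodge index theorem for surfaces = `hodgeIndex_surface_holds`
(`HodgeTheory/HodgeIndexPrimitiveAlgebraicHolds`), Grothendieck's `Nᵖ ⊆` Hodge coniveau =
`Grothendieck1969_supportedClasses_le_hodgeConiveau_holds` (`HodgeTheory/SupportedClassesHodgeConiveauHolds`). -/

/-- STUB (named fact, the one undischarged leaf of the K3 marking): **`b₂(S) = 22`** for a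
projective K3 surface `S` (Huybrechts Ch. 1 §3.3 p. 24: "`e(X) = c₂(X) = 24` … since `b₁ = b₃ = 0`
and `b₀ = b₄ = 1`, this shows `b₂(X) = 22`"). In-tree reductions (both still leaning on unproved
inputs): `K3_finrank_complexBetti_two_of_relEuler` (`Surfaces/K3LatticeInvariantsProofs`: needs
`e(S(ℂ)) = 24` and `Huybrechts_K3_oddBetti_vanish`), `K3_finrank_complexBetti_two_of_hirzebruch_of_oddBetti`
(`Surfaces/K3LatticeInvariantsChernProofs`: needs the Hirzebruch signature theorem for almost-complex
fourfolds, `Geometry.Symplectic.hirzebruch_firstChernClass_sq_eq_almostComplex_four`, and odd Betti).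
[cite: Huybrechts2016K3, Ch. 1 §2.4 (2.6) and §3.3 (p. 24)] -/
theorem anchorExistence_stub_k3BettiTwo : K3_finrank_complexBetti_two := by
  sorry

/-- GLUE (wave 1, worker `stub anchorExistence_stub_k3Marking`; the former stub
`anchorExistence_stub_k3Marking` reshaped to its single undischarged leaf `b₂ = 22`): **every
projective K3 surface over `ℂ` is marked** — `Huybrechts_K3_marking_exists` by the tree's assembly
`Huybrechts_K3_marking_exists_holds_of`, six of whose seven inputs are now the tree's THEOREMS
(`K3_even_intersectionForm_holds`, `K3_exists_orientation_signature_hodgeRiemann_ample_of_finrank_complexBetti_two`,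
`Voisin2002_closedForm_top_zero_not_exact_holds`, `Huybrechts_K3_hodgeTypes_H2_holds`,
`hodgePQ_independent_of_hodgeModel_holds`, `exists_deRhamIsoFamily_holds`), the seventh being the stub
`anchorExistence_stub_k3BettiTwo`. [cite: Huybrechts2016K3, Ch. 1 Prop. 3.5 and its proof (p. 24)] -/
theorem anchorExistence_k3Marking : Huybrechts_K3_marking_exists :=
  Huybrechts_K3_marking_exists_holds_of anchorExistence_stub_k3BettiTwo K3_even_intersectionForm_holds
    (K3_exists_orientation_signature_hodgeRiemann_ample_of_finrank_complexBetti_two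
      anchorExistence_stub_k3BettiTwo)
    (fun E _ _ _ M _ _ => HodgeTheory.Voisin2002_closedForm_top_zero_not_exact_holds E M)
    Huybrechts_K3_hodgeTypes_H2_holds HodgeTheory.hodgePQ_independent_of_hodgeModel_holds
    (fun E _ _ _ => Literature.NumberTheory.Transcendental.exists_deRhamIsoFamily_holds E)

/-- STUB (named fact): the odd Betti cohomology of a projective K3 surface vanishes,
`H¹(S(ℂ); ℂ) = 0 = H³(S(ℂ); ℂ)`. In-tree reduction (`Surfaces/K3BettiNumbersProofs`):
`Huybrechts_K3_oddBetti_vanish_of_cech` / `…_of_isAnalytification` / (wave 1, p135347,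
`Surfaces/K3BettiNumbersOfGAGA`) `…_of_forall_hodgeModel_subsingleton_H_one`; the remaining input is the
GAGA step `H¹(S, 𝒪_S) = 0 ⟹ H¹(S^an, 𝒪_{S^an}) = 0` (Serre, GAGA §3 n°12 Thm. 1 at `q = 1`, `F = 𝒪_S`),
typed verbatim as the hypothesis of `Huybrechts_K3_oddBetti_vanish_of_forall_hodgeModel_subsingleton_H_one`.
[cite: Huybrechts2016K3, Ch. 1 §3.2–3.3] [cite: SerreGAGA1956, §3 n°12 Thm. 1] -/
theorem anchorExistence_stub_k3OddBetti : Huybrechts_K3_oddBetti_vanish := by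
  sorry

/-- STUB (named fact, leaf 1 of Buskin's Thm. 1.1): **Buskin's Prop. 6.2 for reflective
isometries** — a Hodge isometry of cyclic type `η⁻¹ ∘ s_v ∘ η'` between marked projective K3
surfaces is algebraic (Mukai's moduli of sheaves, twistor lines, hyperholomorphic transport, global
Torelli). Partial cases only in `Surfaces/K3SurfaceBuskinReflectiveProofs` (self/iso/Torelli data).
[cite: Buskin2019, §6.2 Prop. 6.2 and §3 Example 3.2] -/
theorem anchorExistence_stub_buskinReflective : Buskin2019_reflectiveHodgeIsometry_algebraic := by
  sorry

/-- STUB (named fact, leaf 2 of Buskin's Thm. 1.1): **cup products of algebraic classes are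
algebraic on a triple product of smooth projective surfaces**, `N²H⁴ ∪ N²H⁴ ⊆ N⁴H⁸` on
`A ⊗ (B ⊗ C)` (Voisin II Prop. 9.20 / Fulton §19.2 instance; in-tree reductions
`…_of_sixfolds/_of_cupProduct/_of_moving` in `Surfaces/K3SurfaceBuskinLeavesProofs`, general form
`Voisin2003_cupProduct_algebraicClasses ⇔ fulton1998_map_mem_algebraicClasses` open at the moving
lemma; wave-1 hint: the consumer `corrCompClass_mem_algebraicClasses` only needs pulled-back pairs
`p₁₂^*γ ∪ p₂₃^*γ'`, dischargeable from the PROVED Deligne 8.2.8 / Voisin lift / Hironaka / Lefschetz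
`(1,1)` without Chow's moving lemma — a multi-session re-plumbing, recorded for the librarian).
[cite: VoisinHodgeII2003, §9.2.4 Prop. 9.20] [cite: Fulton1998, §19.2] -/
theorem anchorExistence_stub_cupTripleSurfaces : cupProduct_mem_algebraicClasses_tripleProduct_surfaces := by
  sorry

/-- STUB (named fact, leaf 3 of Buskin's Thm. 1.1): **surjectivity of the period map for
projective K3 surfaces** (Huybrechts Ch. 6–7; Todorov, Siu, Looijenga), file
`Surfaces/K3PeriodSurjectivity`. [cite: Huybrechts2016K3, Ch. 7 Thm. 4.1 and Ch. 6 Rem. 3.3] -/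
theorem anchorExistence_stub_k3PeriodSurjective : Huybrechts_K3_periodSurjective_projective := by
  sorry

/-- GLUE (wave 1, worker `stub anchorExistence_stub_buskin`; the former stub
`anchorExistence_stub_buskin` reshaped to its undischarged leaves): **Buskin's Theorem 1.1** — every
rational Hodge isometry `H²(S(ℂ); ℚ) → H²(S'(ℂ); ℚ)` between projective K3 surfaces is algebraic — by
the tree's PROVED assembly `Buskin2019_hodgeIsometry_algebraic_holds_of` (the printed §6.2: signs,
Cartan–Dieudonné, chain of marked K3 surfaces, composition of correspondences, all proved in
`Surfaces/K3CorrespondenceComposition`) from the three leaf stubs above and the marking glue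
`anchorExistence_k3Marking`. [cite: Buskin2019, Thm. 1.1 and §6.2] [cite: Huybrechts2019, §1.1] -/
theorem anchorExistence_buskin : Buskin2019_hodgeIsometry_algebraic :=
  Buskin2019_hodgeIsometry_algebraic_holds_of anchorExistence_stub_buskinReflective
    anchorExistence_stub_cupTripleSurfaces anchorExistence_stub_k3PeriodSurjective anchorExistence_k3Marking

/-- GLUE (former bundle stub `anchorExistence_stub_k3SquareFacts`, minus Deligne's partie fixe which the
line no longer needs — see `anchorExistence_k3Square_anchor_of_realMult`): the five named facts the
K3-square FLOORS consume — two of them now the tree's theorems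
(`Grothendieck1969_supportedClasses_le_hodgeConiveau_holds`, `hodgeIndex_surface_holds`), one the stub
`anchorExistence_stub_k3OddBetti`, two (marking, Buskin) assembled from the single-leaf stubs above.
[cite: Huybrechts2016K3, Ch. 1 §3.2–3.3 and Ch. 3 §3.2]
[cite: GrothendieckTopology1969, p. 299 (∗) and p. 300] [cite: Hartshorne1977, V Thm. 1.9] [cite: Buskin2019, Thm. 1.1] -/
theorem anchorExistence_k3SquareFacts :
    Huybrechts_K3_marking_exists ∧ Grothendieck1969_supportedClasses_le_hodgeConiveau ∧
      Huybrechts_K3_oddBetti_vanish ∧ (∀ S : SchemeOver ℂ, hodgeIndex_surface S) ∧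
      Buskin2019_hodgeIsometry_algebraic :=
  ⟨anchorExistence_k3Marking, Grothendieck1969_supportedClasses_le_hodgeConiveau_holds,
    anchorExistence_stub_k3OddBetti, fun _ => hodgeIndex_surface_holds, anchorExistence_buskin⟩

/-! LANDED stubs (imported above): `anchorExistence_k3Square_floor_of_ratEnd` — the `K = ℚ` floor —
`Theorems/AnchorTransportAnchorExistenceK3SquareRatEndFloor.lean` (p97645); `anchorExistence_k3Square_floor_of_CM`
— the CM floor, Buskin's corollary DERIVED from his Thm. 1.1 on the tree's carriers —
`Theorems/AnchorTransportAnchorExistenceK3SquareCMFloor.lean` (p113529) with eight helper modules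
`…K3SquareCMFloor{Complexification,Signature,SignatureReal,Transcendental,Polarization,Span,Decomposition,Endomorphisms}`. -/

/-- STUB (the line's heart — GEOGRAPHY of real-multiplication K3 squares, flat-section form): for a
projective K3 surface `S` which is neither of rational endomorphism type (`End_Hdg(T) = ℚ`) nor CM — so
that, by Zarhin, `End_Hdg(T(S)_ℚ)` is a totally real field `K ≠ ℚ` — and a rational `(2,2)`-class `c` on
`S ⊗ S`: there is a smooth projective family `f : 𝒳 ⟶ B` of relative dimension `4`, with `𝒳`
quasi-projective, over a smooth irreducible QUASI-PROJECTIVE base, a point `s₁` with `e : S ⊗ S ≅ 𝒳_{s₁}`,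
a FLAT family `w` of fibre classes (a continuous section of the espace étalé of `R⁴f_*ℂ`) with rational
`(2,2)` values and `e^*(w s₁) = c` — i.e. `B` maps to the Hodge locus of `c` — and a point `s₀` whose
fibre is `S₀ ⊗ S₀` for a CM K3 surface `S₀`. (Cycle-2 reshape: the smooth compactification `𝒳 ⊆ 𝒳̄` of
the cycle-1 signature is no longer asked for — the glue below runs on Deligne 1968, PROVED in the tree,
instead of the partie fixe, so quasi-projectivity of `𝒳` is all it needs; the old signature implies the
new one via `⟨𝒳̄, i, h𝒳̄, hi⟩ : IsQuasiProjectiveOver 𝒳`.) In print: the self-fibre-product of the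
universal family over (a neat level cover of) the `(NS(S), End_Hdg T(S))`-polarised orthogonal Shimura
variety, of dimension `dim_K T − 2 ≥ 1` (van Geemen 2008 §3), on which the Künneth/`K`-components of `c`
are flat and Hodge everywhere and CM points are dense.
[cite: vanGeemen2008RealMultK3, §3] [cite: CattaniDeligneKaplan1995JAMS, Thm. 1.1] -/
theorem anchorExistence_k3Square_flatSection_of_realMult :
    ∀ S : SchemeOver ℂ, IsK3Surface S →
      ¬ (∀ f : complexBetti S (2 * 1) →ₗ[ℂ] complexBetti S (2 * 1),
        (∀ x, IsRationalClass x → IsRationalClass (f x)) →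
        (∀ (i j : ℕ) x, IsOfHodgeType 2 S (2 * 1) i j x → IsOfHodgeType 2 S (2 * 1) i j (f x)) →
        (∀ d ∈ algebraicClasses S 1, f d = 0) →
        (∀ x : complexBetti S (2 * 1), ∀ d ∈ algebraicClasses S 1,
          cupProduct (rfl : 2 * 1 + 2 * 1 = 2 * 2) (f x) d = 0) →
        ∃ a : ℚ, ∀ x : complexBetti S (2 * 1),
          (∀ d ∈ algebraicClasses S 1, cupProduct (rfl : 2 * 1 + 2 * 1 = 2 * 2) x d = 0) →
          f x = (a : ℂ) • x) →
      ¬ HasComplexMultiplication S →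
      ∀ c : complexBetti (S ⊗ S) (2 * 2), IsRationalClass c → IsOfHodgeType 4 (S ⊗ S) (2 * 2) 2 2 c →
      ∃ (𝒳 B : SchemeOver ℂ) (f : 𝒳 ⟶ B) (s₁ s₀ : ComplexPoints B)
        (e : S ⊗ S ≅ fiberOver f s₁) (S₀ : SchemeOver ℂ) (_e₀ : fiberOver f s₀ ≅ S₀ ⊗ S₀)
        (w : ∀ s : ComplexPoints B, complexBetti (fiberOver f s) (2 * 2)),
        IsSmoothProjectiveFamily f 4 ∧ IrreducibleSpace B.left ∧ AlgebraicGeometry.Smooth B.hom ∧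
        IsQuasiProjectiveOver B ∧ IsQuasiProjectiveOver 𝒳 ∧
        (Continuous fun s => (⟨s, w s⟩ : FiberClass f (2 * 2))) ∧
        (∀ s : ComplexPoints B, IsRationalClass (w s) ∧ IsOfHodgeType 4 (fiberOver f s) (2 * 2) 2 2 (w s)) ∧
        complexBetti.map e.hom (2 * 2) (w s₁) = c ∧
        IsK3Surface S₀ ∧ HasComplexMultiplication S₀ := by
  sorry

/-- STUB (declared complement of the line's sector): in the middle range `2 ≤ p ≤ n − 2`, off K3
squares, every rational `(p,p)`-class which is NOT ALREADY ALGEBRAIC is anchored in the sense of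
`AnchorExistence` (algebraic classes are anchored by the constant family, so this is the whole residue;
by the disprover's `ConstantClause` any anchor here has `s₀ ≠ s₁` and, by tightness
`anchorTransport_mem_algebraicClasses_of_anchor_of_fiberIso`, an anchor fibre not compatibly isomorphic
to `X`: the statement is exactly the anchor GEOGRAPHY of the Hodge loci of non-algebraic Hodge classes —
Fermat/CM/boundary members — and is sandwiched with the Hodge conjecture there).
[cite: CattaniDeligneKaplan1995JAMS, Thm. 1.1] -/
theorem anchorExistence_anchor_offK3Squares_of_not_mem :
    ∀ ⦃n : ℕ⦄ ⦃X : SchemeOver ℂ⦄, IsSmoothProjective n X →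
      (∀ S : SchemeOver ℂ, IsK3Surface S → IsEmpty (X ≅ S ⊗ S)) →
      ∀ (p : ℕ), 2 ≤ p → p + 2 ≤ n →
      ∀ (c : complexBetti X (2 * p)), IsRationalClass c → IsOfHodgeType n X (2 * p) p p c →
      c ∉ algebraicClasses X p →
      ∃ (𝒳 S : SchemeOver ℂ) (f : 𝒳 ⟶ S) (s₁ s₀ : ComplexPoints S) (e : X ≅ fiberOver f s₁)
        (A : complexBetti 𝒳 (2 * p)),
        IsSmoothProjectiveFamily f n ∧ IrreducibleSpace S.left ∧ AlgebraicGeometry.Smooth S.hom ∧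
        (∀ s : ComplexPoints S, IsRationalClass (complexBetti.map (fiberι f s) (2 * p) A) ∧
          IsOfHodgeType n (fiberOver f s) (2 * p) p p (complexBetti.map (fiberι f s) (2 * p) A)) ∧
        complexBetti.map e.hom (2 * p) (complexBetti.map (fiberι f s₁) (2 * p) A) = c ∧
        complexBetti.map (fiberι f s₀) (2 * p) A ∈ algebraicClasses (fiberOver f s₀) p := by
  sorry

/-! ### Glue (kernel-checked) -/

/-- Two smooth projective `ℂ`-schemes that are isomorphic over `ℂ` have the same dimension
(`schemeDim` is a homeomorphism invariant and equals the relative dimension,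
`Motives.schemeDim_eq_holds`). [cite: Hartshorne1977, II Ex. 3.20 and III.10] -/
theorem anchorExistence_dim_eq_of_iso {n m : ℕ} {X Y : SchemeOver ℂ} (hX : IsSmoothProjective n X)
    (hY : IsSmoothProjective m Y) (g : X ≅ Y) : n = m := by
  have h₁ := schemeDim_eq_holds hX
  have h₂ := schemeDim_eq_holds hY
  unfold schemeDim at h₁ h₂
  have hdim : topologicalKrullDim ↥(X.left) = topologicalKrullDim ↥(Y.left) :=
    IsHomeomorph.topologicalKrullDim_eq _
      (TopCat.homeoOfIso (Scheme.forgetToTop.mapIso ((Over.forget _).mapIso g))).isHomeomorph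
  rw [hdim] at h₁
  exact h₁.symm.trans h₂

/-- **Real-multiplication K3 squares are CM-anchored** (GLUE): from the flat-section geography
(`anchorExistence_k3Square_flatSection_of_realMult`) and Deligne's 1968 theorem "invariant classes come
from the total space" (Voisin II Thm. 4.18 — the tree's THEOREM
`deligne1968_invariantClass_fromTotalSpace_holds`; cycle 1 used the stronger partie fixe, Hodge II 4.1.1,
as a stub, which the anchor shape does not need: `A` lives on the open total space `𝒳`): the flat family
`w` is `A|_{𝒳_{s₁}}` at `s₁` for some `A ∈ H⁴(𝒳(ℂ); ℂ)`, hence `w s = A|_{𝒳_s}` for EVERY `s` by the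
identity principle for flat families over the connected base `B(ℂ)` (`eq_map_fiberι_of_continuous_of_eq_at`:
SGA1 XII 2.4 connectedness, Ehresmann local triviality), so `A` is fibrewise rational `(2,2)`, restricts
to `c` through `e`, and meets the CM square `S₀ ⊗ S₀` at `s₀`.
[cite: VoisinHodgeII2003, Thm. 4.18] [cite: CharlesSchnell2014Notes, Proposition 11.3.5] -/
theorem anchorExistence_k3Square_anchor_of_realMult :
    ∀ S : SchemeOver ℂ, IsK3Surface S →
      ¬ (∀ f : complexBetti S (2 * 1) →ₗ[ℂ] complexBetti S (2 * 1),
        (∀ x, IsRationalClass x → IsRationalClass (f x)) →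
        (∀ (i j : ℕ) x, IsOfHodgeType 2 S (2 * 1) i j x → IsOfHodgeType 2 S (2 * 1) i j (f x)) →
        (∀ d ∈ algebraicClasses S 1, f d = 0) →
        (∀ x : complexBetti S (2 * 1), ∀ d ∈ algebraicClasses S 1,
          cupProduct (rfl : 2 * 1 + 2 * 1 = 2 * 2) (f x) d = 0) →
        ∃ a : ℚ, ∀ x : complexBetti S (2 * 1),
          (∀ d ∈ algebraicClasses S 1, cupProduct (rfl : 2 * 1 + 2 * 1 = 2 * 2) x d = 0) →
          f x = (a : ℂ) • x) →
      ¬ HasComplexMultiplication S →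
      ∀ c : complexBetti (S ⊗ S) (2 * 2), IsRationalClass c → IsOfHodgeType 4 (S ⊗ S) (2 * 2) 2 2 c →
      ∃ (𝒳 B : SchemeOver ℂ) (f : 𝒳 ⟶ B) (s₁ s₀ : ComplexPoints B) (e : S ⊗ S ≅ fiberOver f s₁)
        (A : complexBetti 𝒳 (2 * 2)) (S₀ : SchemeOver ℂ) (_e₀ : fiberOver f s₀ ≅ S₀ ⊗ S₀),
        IsSmoothProjectiveFamily f 4 ∧ IrreducibleSpace B.left ∧ AlgebraicGeometry.Smooth B.hom ∧
        (∀ s : ComplexPoints B, IsRationalClass (complexBetti.map (fiberι f s) (2 * 2) A) ∧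
          IsOfHodgeType 4 (fiberOver f s) (2 * 2) 2 2 (complexBetti.map (fiberι f s) (2 * 2) A)) ∧
        complexBetti.map e.hom (2 * 2) (complexBetti.map (fiberι f s₁) (2 * 2) A) = c ∧
        IsK3Surface S₀ ∧ HasComplexMultiplication S₀ := by
  intro S hS hQ hCM c hc hpp
  obtain ⟨𝒳, B, f, s₁, s₀, e, S₀, e₀, w, hf, hirr, hsm, hqp, hq𝒳, hwc, hw, hws₁, hS₀, hCM₀⟩ :=
    anchorExistence_k3Square_flatSection_of_realMult S hS hQ hCM c hc hpp
  -- invariant classes come from the total space (Deligne 1968), at `s₁`: `w s₁ = A|_{𝒳_{s₁}}`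
  obtain ⟨A, hA⟩ := deligne1968_invariantClass_fromTotalSpace_holds 𝒳 B f 4 hf hq𝒳 hqp hsm (2 * 2)
    (fun s => (⟨s, w s⟩ : FiberClass f (2 * 2))) hwc (fun _ => rfl) s₁
  have hw₁ : w s₁ = complexBetti.map (fiberι f s₁) (2 * 2) A := by
    change (⟨s₁, w s₁⟩ : FiberClass f (2 * 2)) = ⟨s₁, complexBetti.map (fiberι f s₁) (2 * 2) A⟩ at hA
    simp only [FiberClass.mk.injEq, heq_eq_eq, true_and] at hA
    exact hA
  -- identity principle over the connected base `B(ℂ)`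
  haveI := hsm
  haveI := hirr
  haveI : LocallyOfFiniteType B.hom := hqp.locallyOfFiniteType
  haveI : ConnectedSpace (ComplexPoints B) := (ComplexPoints.connectedSpace_iff_holds B).2 inferInstance
  obtain ⟨d, hd⟩ := exists_smoothOfRelativeDimension_of_connectedSpace_complexPoints B
  haveI := hd
  haveI := pathConnectedSpace_complexPoints_of_smoothOfRelativeDimension B d
  have hU := isCohomologicallyLocallyTrivialOn_univ_of_isSmoothProjectiveFamily f d hf hqp
  have hwall : ∀ s, w s = complexBetti.map (fiberι f s) (2 * 2) A :=
    eq_map_fiberι_of_continuous_of_eq_at f (2 * 2) hU w hwc A hw₁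
  refine ⟨𝒳, B, f, s₁, s₀, e, A, S₀, e₀, hf, hirr, hsm, fun s => ?_, ?_, hS₀, hCM₀⟩
  · rw [← hwall s]
    exact hw s
  · rw [← hwall s₁]
    exact hws₁

/-- **The K3-square sector at `p = 2`**: every rational `(2,2)`-class on `S ⊗ S`, `S` a projective K3
surface, is anchored — by the constant family when `End_Hdg(T) = ℚ` (floor
`anchorExistence_k3Square_floor_of_ratEnd`) or `S` is CM (Buskin floor), and by the CM-anchored
real-multiplication family otherwise (`anchorExistence_k3Square_anchor_of_realMult`, anchored at the
Buskin floor `S₀ ⊗ S₀` through `anchorTransport_anchor_of_floor`). [cite: Huybrechts2019, Cor. 0.4 (ii)]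
[cite: Varesco2023, §2 (p. 8)] -/
theorem anchorExistence_anchor_k3Square {S : SchemeOver ℂ} (hS : IsK3Surface S)
    (c : complexBetti (S ⊗ S) (2 * 2)) (hc : IsRationalClass c)
    (hpp : IsOfHodgeType 4 (S ⊗ S) (2 * 2) 2 2 c) :
    ∃ (𝒳 B : SchemeOver ℂ) (f : 𝒳 ⟶ B) (s₁ s₀ : ComplexPoints B) (e : S ⊗ S ≅ fiberOver f s₁)
      (A : complexBetti 𝒳 (2 * 2)),
      IsSmoothProjectiveFamily f 4 ∧ IrreducibleSpace B.left ∧ AlgebraicGeometry.Smooth B.hom ∧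
      (∀ s : ComplexPoints B, IsRationalClass (complexBetti.map (fiberι f s) (2 * 2) A) ∧
        IsOfHodgeType 4 (fiberOver f s) (2 * 2) 2 2 (complexBetti.map (fiberι f s) (2 * 2) A)) ∧
      complexBetti.map e.hom (2 * 2) (complexBetti.map (fiberι f s₁) (2 * 2) A) = c ∧
      complexBetti.map (fiberι f s₀) (2 * 2) A ∈ algebraicClasses (fiberOver f s₀) 2 := by
  have hSS : IsSmoothProjective 4 (S ⊗ S) := hS.isSmoothProjective_tensor_self
  obtain ⟨hmark, hG, hodd, hHI, hB⟩ := anchorExistence_k3SquareFacts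
  -- the CM floor (Buskin's corollary from Thm. 1.1), used on `S` itself or on the anchor fibre
  have hfloor : ∀ S' : SchemeOver ℂ, IsK3Surface S' → HasComplexMultiplication S' →
      ∀ c' : complexBetti (S' ⊗ S') (2 * 2), IsRationalClass c' →
        IsOfHodgeType 4 (S' ⊗ S') (2 * 2) 2 2 c' → c' ∈ algebraicClasses (S' ⊗ S') 2 :=
    anchorExistence_k3Square_floor_of_CM hB lefschetzOneOne_rational_holds hmark hG hodd hHI
  by_cases hQ : ∀ f : complexBetti S (2 * 1) →ₗ[ℂ] complexBetti S (2 * 1),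
      (∀ x, IsRationalClass x → IsRationalClass (f x)) →
      (∀ (i j : ℕ) x, IsOfHodgeType 2 S (2 * 1) i j x → IsOfHodgeType 2 S (2 * 1) i j (f x)) →
      (∀ d ∈ algebraicClasses S 1, f d = 0) →
      (∀ x : complexBetti S (2 * 1), ∀ d ∈ algebraicClasses S 1,
        cupProduct (rfl : 2 * 1 + 2 * 1 = 2 * 2) (f x) d = 0) →
      ∃ a : ℚ, ∀ x : complexBetti S (2 * 1),
        (∀ d ∈ algebraicClasses S 1, cupProduct (rfl : 2 * 1 + 2 * 1 = 2 * 2) x d = 0) →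
        f x = (a : ℂ) • x
  · -- `End_Hdg(T) = ℚ`: the class is algebraic on `S ⊗ S` itself; constant family
    exact anchorTransport_anchor_of_mem_algebraicClasses hSS 2 c hc hpp
      (anchorExistence_k3Square_floor_of_ratEnd lefschetzOneOne_rational_holds hmark hG hodd hHI
        S hS hQ c hc hpp)
  by_cases hCM : HasComplexMultiplication S
  · -- CM: the class is algebraic on `S ⊗ S` itself; constant family
    exact anchorTransport_anchor_of_mem_algebraicClasses hSS 2 c hc hpp (hfloor S hS hCM c hc hpp)
  · -- real multiplication: CM-anchored family, CM floor at the anchor fibre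
    obtain ⟨𝒳, B, f, s₁, s₀, e, A, S₀, e₀, hf, hirr, hsm, hfib, hAc, hS₀, hCM₀⟩ :=
      anchorExistence_k3Square_anchor_of_realMult S hS hQ hCM c hc hpp
    exact anchorTransport_anchor_of_floor f s₁ s₀ e A hf hirr hsm hfib hAc e₀
      fun c₀ hc₀ hpp₀ => hfloor S₀ hS₀ hCM₀ c₀ hc₀ hpp₀

/-- **Item stmt-HodgeConjecture-1077, line `Sketch`: `AnchorExistence` from the declared stubs.** Case
analysis on the codimension: Lefschetz range (constant family over the Lefschetz-range floor), middle range
on a K3 square (`anchorExistence_anchor_k3Square`, transported along `X ≅ S ⊗ S` by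
`anchorTransport_anchor_map_of_iso`; `n = 4` by `anchorExistence_dim_eq_of_iso`, `p = 2`), middle range off
K3 squares (constant family for algebraic classes, else the declared complement). The type is literally
the route decl. [cite: Deligne2000, §1] -/
theorem anchorTransport_anchorExistence_proof : AnchorExistence := by
  unfold AnchorExistence
  intro n X hX p c hc hpp
  by_cases hrange : p ≤ 1 ∨ n ≤ p + 1
  · -- Lefschetz range: `c` is algebraic on `X`; constant family
    exact anchorTransport_anchor_of_mem_algebraicClasses hX p c hc hpp
      (mem_algebraicClasses_of_lefschetzRange lefschetzOneOne_rational_holds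
        (nonempty_hardLefschetzNFold_holds n X) hX hrange c hc hpp)
  have hp2 : 2 ≤ p := by omega
  have hpn : p + 2 ≤ n := by omega
  by_cases hK3 : ∃ S : SchemeOver ℂ, IsK3Surface S ∧ Nonempty (X ≅ S ⊗ S)
  · -- K3 square: `n = 4`, `p = 2`; anchor `(S ⊗ S, (g⁻¹)^* c)` and transport along `g`
    obtain ⟨S, hS, ⟨g⟩⟩ := hK3
    have hSS : IsSmoothProjective 4 (S ⊗ S) := hS.isSmoothProjective_tensor_self
    obtain rfl : n = 4 := anchorExistence_dim_eq_of_iso hX hSS g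
    obtain rfl : p = 2 := by omega
    have h := anchorExistence_anchor_k3Square hS (complexBetti.map g.inv (2 * 2) c) (hc.map _)
      (hpp.map_of_iso g.symm)
    have h' := anchorTransport_anchor_map_of_iso (n := 4) g h
    have hid : complexBetti.map g.hom (2 * 2) (complexBetti.map g.inv (2 * 2) c) = c := by
      change (complexBetti.map g.inv (2 * 2) ≫ complexBetti.map g.hom (2 * 2)) c = c
      rw [← complexBetti.map_comp, Iso.hom_inv_id, complexBetti.map_id]
      rfl
    rwa [hid] at h'
  · -- off K3 squares: algebraic classes by the constant family, the rest is the declared complement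
    by_cases halg : c ∈ algebraicClasses X p
    · exact anchorTransport_anchor_of_mem_algebraicClasses hX p c hc hpp halg
    have hK3' : ∀ S : SchemeOver ℂ, IsK3Surface S → IsEmpty (X ≅ S ⊗ S) := fun S hS =>
      ⟨fun g => hK3 ⟨S, hS, ⟨g⟩⟩⟩
    exact anchorExistence_anchor_offK3Squares_of_not_mem hX hK3' p hp2 hpn c hc hpp halg

end Summit.HodgeConjecture.HodgeConjecture.Theorems

end
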